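import Mathlib
import Summits.MatrixMultiplication.MatrixMultiplication.Theorems.SnSubsetDichotomyPolynomialSlackMixedCertificate
import Summits.MatrixMultiplication.MatrixMultiplication.Theorems.SnSubsetDichotomyPolynomialSlackCertificateLevels

/-!
# The mixed entropy certificate on row blocks AND column blocks (3/4 step)

Crux `Summit.MatrixMultiplication.MatrixMultiplication.Theses.SnSubsetDichotomy.PolynomialSlack`
(item `stmt-MatrixMultiplication-8306`), level-one programme, line transport-split-hull (lead c10).
The analogue of c9's `certificate_blocks` (`…CertificateLevels`) for TWO families of atoms of a set
`A ⊆ S_n` with profile `d(i,j) = #{a : a j = i}/|A|`: ROW atoms `p = (k, ℓ)` with a block `Brow p` of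
VALUES at the position `k` (mass `Σ_{i ∈ Brow p} d(i,k) = P_A(a k ∈ Brow p)`), and COLUMN atoms
`q = (i, ℓ)` with a block `Bcol q` of POSITIONS at the value `i` (mass
`Σ_{k ∈ Bcol q} d(i,k) = P_A(a⁻¹ i ∈ Bcol q)`), under the disjointness "row blocks avoid the column atoms'
values" (`q.1 ∉ Brow p`), few positions and values (`2(|P|+|V|)² ≤ n`):
`Σ_{IncR} σ_p (log n − log x_p) + Σ_{IncC} σ_q (log n − log y_q) ≤ log(n!/|A|) + S log(S/ε) + 2`.
Proof: `log_density_ge_certificate_mixed` with `φ k v = λ_p` on `v ∈ Brow p` (`p ∈ IncR` at position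
`k`), `ψ i k' = λ_q` on `k' ∈ Bcol q` (`q ∈ IncC` at value `i`), `1` elsewhere,
`λ = max 1 (n σ/(x S))`, exactly as in `certificate_blocks`.

The private lemmas isolate the pieces of the proof of `certificate_blocks` that are used twice
(once per family): the block weight `1 + ∑_{p ∈ Inc at k} [v ∈ B p] (λ p - 1)`, its logarithm, its
column sum, the count of permutations hitting a block, and the two scalar estimates.
-/

namespace Summit.MatrixMultiplication.MatrixMultiplication.Theorems.PolynomialSlack

open scoped BigOperators

set_option linter.dupNamespace false

/-- The block weight `1 + ∑_{p ∈ Inc at k} [v ∈ B p] (λ p - 1)` is at least `1` when `λ ≥ 1`. -/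
private theorem one_le_blockWeight {n m : ℕ} (B : Fin n × Fin m → Finset (Fin n))
    (Inc : Finset (Fin n × Fin m)) (lam : Fin n × Fin m → ℝ) (hlam : ∀ p, 1 ≤ lam p)
    (k v : Fin n) :
    (1 : ℝ) ≤ 1 + ∑ p ∈ Inc.filter (fun p => p.1 = k), if v ∈ B p then lam p - 1 else 0 := by
  refine le_add_of_nonneg_right (Finset.sum_nonneg fun p _ => ?_)
  split_ifs
  · linarith [hlam p]
  · exact le_rfl

/-- When two blocks at the same position sharing a value coincide, at most one block at `k`
contains `v`, so the logarithm of the block weight is additive: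
`log (1 + ∑_{p at k} [v ∈ B p] (λ p - 1)) = ∑_{p at k} [v ∈ B p] log (λ p)`. -/
private theorem log_blockWeight {n m : ℕ} (B : Fin n × Fin m → Finset (Fin n))
    (hB : ∀ p q : Fin n × Fin m, p.1 = q.1 → ∀ i ∈ B p, i ∈ B q → p = q)
    (Inc : Finset (Fin n × Fin m)) (lam : Fin n × Fin m → ℝ) (k v : Fin n) :
    Real.log (1 + ∑ p ∈ Inc.filter (fun p => p.1 = k), if v ∈ B p then lam p - 1 else 0) =
      ∑ p ∈ Inc.filter (fun p => p.1 = k), if v ∈ B p then Real.log (lam p) else 0 := by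
  classical
  by_cases h : ∃ p ∈ Inc.filter (fun p => p.1 = k), v ∈ B p
  · obtain ⟨p, hp, hv⟩ := h
    have huniq : ∀ q ∈ Inc.filter (fun p => p.1 = k), q ≠ p → v ∉ B q :=
      fun q hq hne hvq => hne (hB q p
        ((Finset.mem_filter.1 hq).2.trans (Finset.mem_filter.1 hp).2.symm) v hvq hv)
    rw [Finset.sum_eq_single_of_mem p hp fun q hq hne => if_neg (huniq q hq hne),
      Finset.sum_eq_single_of_mem p hp fun q hq hne => if_neg (huniq q hq hne),
      if_pos hv, if_pos hv, add_sub_cancel]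
  · have h' : ∀ q ∈ Inc.filter (fun p => p.1 = k), v ∉ B q := fun q hq hvq => h ⟨q, hq, hvq⟩
    rw [Finset.sum_eq_zero fun q hq => if_neg (h' q hq),
      Finset.sum_eq_zero fun q hq => if_neg (h' q hq), add_zero, Real.log_one]

/-- Summing the logarithmic block weights `log w k (a k)` over the positions `k` of `Inc` collects,
for each atom `p ∈ Inc`, the term `[a p.1 ∈ B p] log (λ p)`. -/
private theorem sum_log_blockWeight {n m : ℕ} (B : Fin n × Fin m → Finset (Fin n))
    (hB : ∀ p q : Fin n × Fin m, p.1 = q.1 → ∀ i ∈ B p, i ∈ B q → p = q)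
    (Inc : Finset (Fin n × Fin m)) (lam : Fin n × Fin m → ℝ) (a : Fin n → Fin n) :
    ∑ k ∈ Inc.image Prod.fst, Real.log (1 + ∑ p ∈ Inc.filter (fun p => p.1 = k),
        if a k ∈ B p then lam p - 1 else 0) =
      ∑ p ∈ Inc, if a p.1 ∈ B p then Real.log (lam p) else 0 := by
  symm
  rw [← Finset.sum_fiberwise_of_maps_to (t := Inc.image Prod.fst) (g := Prod.fst)
    (fun p hp => Finset.mem_image_of_mem Prod.fst hp)]
  refine Finset.sum_congr rfl fun k _ => ?_
  rw [log_blockWeight B hB Inc lam k (a k)]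
  refine Finset.sum_congr rfl fun p hp => ?_
  rw [(Finset.mem_filter.1 hp).2]

/-- The column sum of the block weight at `k` is `n + ∑_{p at k} |B p| (λ p - 1)`. -/
private theorem sum_blockWeight {n m : ℕ} (B : Fin n × Fin m → Finset (Fin n))
    (Inc : Finset (Fin n × Fin m)) (lam : Fin n × Fin m → ℝ) (k : Fin n) :
    ∑ v : Fin n, (1 + ∑ p ∈ Inc.filter (fun p => p.1 = k), if v ∈ B p then lam p - 1 else 0) =
      n + ∑ p ∈ Inc.filter (fun p => p.1 = k), ((B p).card : ℝ) * (lam p - 1) := by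
  rw [Finset.sum_add_distrib, Finset.sum_const, Finset.card_univ, Fintype.card_fin,
    nsmul_eq_mul, mul_one, Finset.sum_comm]
  congr 1
  refine Finset.sum_congr rfl fun p _ => ?_
  rw [Finset.sum_ite_mem, Finset.univ_inter, Finset.sum_const, nsmul_eq_mul]

/-- The normalised logarithm of a column sum: if `|B p| (λ p - 1) ≤ n c p` for the atoms at `k`,
then `log ((∑_v w k v)/n) ≤ ∑_{p at k} c p` (by `log t ≤ t - 1`). -/
private theorem log_colsum_blockWeight_le {n m : ℕ} (hn : (0 : ℝ) < n)
    (B : Fin n × Fin m → Finset (Fin n)) (Inc : Finset (Fin n × Fin m))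
    (lam c : Fin n × Fin m → ℝ) (hlam : ∀ p, 1 ≤ lam p) (k : Fin n)
    (hbd : ∀ p ∈ Inc.filter (fun p => p.1 = k), ((B p).card : ℝ) * (lam p - 1) ≤ n * c p) :
    Real.log ((∑ v : Fin n, (1 + ∑ p ∈ Inc.filter (fun p => p.1 = k),
        if v ∈ B p then lam p - 1 else 0)) / n) ≤
      ∑ p ∈ Inc.filter (fun p => p.1 = k), c p := by
  rw [sum_blockWeight B Inc lam k]
  have hT : 0 ≤ ∑ p ∈ Inc.filter (fun p => p.1 = k), ((B p).card : ℝ) * (lam p - 1) :=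
    Finset.sum_nonneg fun p _ => mul_nonneg (Nat.cast_nonneg _) (by linarith [hlam p])
  calc Real.log ((n + ∑ p ∈ Inc.filter (fun p => p.1 = k), ((B p).card : ℝ) * (lam p - 1)) / n)
      ≤ (n + ∑ p ∈ Inc.filter (fun p => p.1 = k), ((B p).card : ℝ) * (lam p - 1)) / n - 1 :=
        Real.log_le_sub_one_of_pos (div_pos (add_pos_of_pos_of_nonneg hn hT) hn)
    _ = (∑ p ∈ Inc.filter (fun p => p.1 = k), ((B p).card : ℝ) * (lam p - 1)) / n := by
        rw [div_sub_one hn.ne', add_sub_cancel_left]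
    _ ≤ (∑ p ∈ Inc.filter (fun p => p.1 = k), n * c p) / n :=
        div_le_div_of_nonneg_right (Finset.sum_le_sum hbd) hn.le
    _ = ∑ p ∈ Inc.filter (fun p => p.1 = k), c p := by
        rw [← Finset.mul_sum, mul_div_cancel_left₀ _ hn.ne']

/-- Counting over `A` the permutations whose image under `f` lies in a block `B`, fibrewise. -/
private theorem sum_ite_mem_eq {n : ℕ} (A : Finset (Equiv.Perm (Fin n)))
    (f : Equiv.Perm (Fin n) → Fin n) (B : Finset (Fin n)) (c : ℝ) :
    ∑ a ∈ A, (if f a ∈ B then c else 0) =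
      (∑ i ∈ B, ((A.filter fun a => f a = i).card : ℝ)) * c := by
  rw [← Finset.sum_filter, Finset.sum_const, nsmul_eq_mul]
  congr 1
  rw [Finset.card_eq_sum_card_fiberwise (f := f) (s := A.filter fun a => f a ∈ B) (t := B)
    (fun a ha => Finset.mem_coe.2 (Finset.mem_filter.1 (Finset.mem_coe.1 ha)).2)]
  push_cast
  refine Finset.sum_congr rfl fun i hi => ?_
  congr 2
  ext a
  simp only [Finset.mem_filter]
  exact ⟨fun h => ⟨h.1.1, h.2⟩, fun h => ⟨⟨h.1, h.2 ▸ hi⟩, h.2⟩⟩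

/-- The scalar lower bound for one atom: with `λ = max 1 (n σ/(x S))`, `σ ≥ ε > 0`, `σ ≤ S` and
`x ≥ 1`, `σ (log n - log x) - σ log (S/ε) ≤ σ log λ`. -/
private theorem mixed_atom_low {n σ x S ε : ℝ} (hn : 0 < n) (hε : 0 < ε) (hσ : ε ≤ σ)
    (hS : σ ≤ S) (hx : 1 ≤ x) :
    σ * (Real.log n - Real.log x) - σ * Real.log (S / ε) ≤
      σ * Real.log (max 1 (n * σ / (x * S))) := by
  have hσ0 : 0 < σ := hε.trans_le hσ
  have hS0 : 0 < S := hσ0.trans_le hS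
  have hx0 : 0 < x := one_pos.trans_le hx
  have ht0 : 0 < n * σ / (x * S) := div_pos (mul_pos hn hσ0) (mul_pos hx0 hS0)
  have h1 : Real.log (n * σ / (x * S)) ≤ Real.log (max 1 (n * σ / (x * S))) :=
    Real.log_le_log ht0 (le_max_right _ _)
  have h2 : Real.log (n * σ / (x * S)) =
      Real.log n + Real.log σ - (Real.log x + Real.log S) := by
    rw [Real.log_div (mul_pos hn hσ0).ne' (mul_pos hx0 hS0).ne', Real.log_mul hn.ne' hσ0.ne',
      Real.log_mul hx0.ne' hS0.ne']
  have h3 : Real.log (S / ε) = Real.log S - Real.log ε := Real.log_div hS0.ne' hε.ne'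
  have h4 : Real.log ε ≤ Real.log σ := Real.log_le_log hε hσ
  have key : Real.log n - Real.log x - Real.log (S / ε) ≤
      Real.log (max 1 (n * σ / (x * S))) := by
    rw [h3]
    linarith
  have := mul_le_mul_of_nonneg_left key hσ0.le
  linarith

/-- The scalar column-sum bound for one atom: `c (λ - 1) ≤ n σ/S` when `c ≤ x`, `x ≥ 1`. -/
private theorem mixed_atom_col {n σ x S c : ℝ} (hn : 0 < n) (hσ : 0 < σ) (hS : 0 < S)
    (hx : 1 ≤ x) (hc : c ≤ x) :
    c * (max 1 (n * σ / (x * S)) - 1) ≤ n * (σ / S) := by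
  have hx0 : 0 < x := one_pos.trans_le hx
  have ht0 : 0 < n * σ / (x * S) := div_pos (mul_pos hn hσ) (mul_pos hx0 hS)
  have hsub : max 1 (n * σ / (x * S)) - 1 ≤ n * σ / (x * S) := by
    rw [sub_le_iff_le_add]
    exact max_le (by linarith) (by linarith)
  have h0 : 0 ≤ max 1 (n * σ / (x * S)) - 1 := by
    linarith [le_max_left 1 (n * σ / (x * S))]
  calc c * (max 1 (n * σ / (x * S)) - 1) ≤ x * (n * σ / (x * S)) := mul_le_mul hc hsub h0 hx0.le
    _ = n * (σ / S) := by
        rw [← mul_div_assoc, mul_div_mul_left _ _ hx0.ne', mul_div_assoc]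

/-- Few positions and values: `2 r² ≤ n` and `n ≥ 2` give `r < n` and the injectivity defect
`r log (n/(n - r)) ≤ r²/(n - r) ≤ 1`. -/
private theorem mixed_few {n r : ℕ} (hn : 2 ≤ n) (hr : 2 * (r : ℝ) ^ 2 ≤ n) :
    r < n ∧ (r : ℝ) * Real.log ((n : ℝ) / (n - r)) ≤ 1 := by
  have hnR : (2 : ℝ) ≤ n := by exact_mod_cast hn
  have hn0 : (0 : ℝ) < n := by linarith
  have hrn : r < n := by
    by_contra h
    have h' : (n : ℝ) ≤ r := by exact_mod_cast not_lt.1 h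
    nlinarith [mul_nonneg (sub_nonneg.2 (hnR.trans h')) (Nat.cast_nonneg r)]
  refine ⟨hrn, ?_⟩
  have hrR : (r : ℝ) < n := by exact_mod_cast hrn
  have hnr : (0 : ℝ) < n - r := sub_pos.2 hrR
  have hr2 : (r : ℝ) ^ 2 + r ≤ n := by
    rcases Nat.eq_zero_or_pos r with h0 | h1
    · rw [h0, Nat.cast_zero]
      linarith
    · have h1' : (1 : ℝ) ≤ r := by exact_mod_cast h1
      nlinarith [mul_nonneg (sub_nonneg.2 h1') (Nat.cast_nonneg r)]
  have hlog : Real.log ((n : ℝ) / (n - r)) ≤ r / (n - r) := by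
    calc Real.log ((n : ℝ) / (n - r)) ≤ (n : ℝ) / (n - r) - 1 :=
          Real.log_le_sub_one_of_pos (div_pos hn0 hnr)
      _ = r / (n - r) := by
          rw [div_sub_one hnr.ne', sub_sub_cancel]
  calc (r : ℝ) * Real.log ((n : ℝ) / (n - r))
      ≤ r * (r / (n - r)) := mul_le_mul_of_nonneg_left hlog (Nat.cast_nonneg _)
    _ = (r : ℝ) ^ 2 / (n - r) := by ring
    _ ≤ 1 := by
        rw [div_le_one hnr]
        linarith

/-- **Mixed entropy certificate on two block families.** Let `A ⊆ S_n` be non-empty (`n ≥ 2`) with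
profile `d`, `Brow` row blocks (values at a position; two blocks at the same position sharing a value
coincide) with included atoms `IncR`, `Bcol` column blocks (positions at a value; same coincidence
condition) with included atoms `IncC`, all included masses `≥ ε > 0`, row blocks of `IncR` avoiding the
values of `IncC`, and `2(|positions of IncR| + |values of IncC|)² ≤ n`.  Then
`Σ_{p ∈ IncR} σ_p (log n - log (max |Brow p| 1)) + Σ_{q ∈ IncC} σ_q (log n - log (max |Bcol q| 1))
  ≤ log (n!/|A|) + S log (S/ε) + 2`, `S` the total included mass. [folklore] -/
theorem certificate_mixed_blocks {n m : ℕ} (hn : 2 ≤ n) (A : Finset (Equiv.Perm (Fin n)))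
    (hA : A.Nonempty) (d : Fin n → Fin n → ℝ)
    (hd : ∀ i j, d i j = ((A.filter fun a => a j = i).card : ℝ) / A.card)
    (Brow : Fin n × Fin m → Finset (Fin n))
    (hBrow : ∀ p q : Fin n × Fin m, p.1 = q.1 → ∀ i ∈ Brow p, i ∈ Brow q → p = q)
    (Bcol : Fin n × Fin m → Finset (Fin n))
    (hBcol : ∀ p q : Fin n × Fin m, p.1 = q.1 → ∀ k ∈ Bcol p, k ∈ Bcol q → p = q)
    (IncR IncC : Finset (Fin n × Fin m)) (ε : ℝ) (hε : 0 < ε)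
    (hεR : ∀ p ∈ IncR, ε ≤ ∑ i ∈ Brow p, d i p.1)
    (hεC : ∀ q ∈ IncC, ε ≤ ∑ k ∈ Bcol q, d q.1 k)
    (hdisj : ∀ p ∈ IncR, ∀ q ∈ IncC, q.1 ∉ Brow p)
    (hPV : 2 * (((IncR.image Prod.fst).card : ℝ) + ((IncC.image Prod.fst).card : ℝ)) ^ 2 ≤ n) :
    ∑ p ∈ IncR, (∑ i ∈ Brow p, d i p.1) * (Real.log n - Real.log (max ((Brow p).card : ℝ) 1)) +
      ∑ q ∈ IncC, (∑ k ∈ Bcol q, d q.1 k) * (Real.log n - Real.log (max ((Bcol q).card : ℝ) 1)) ≤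
      Real.log ((n.factorial : ℝ) / A.card) +
        ((∑ p ∈ IncR, ∑ i ∈ Brow p, d i p.1) + ∑ q ∈ IncC, ∑ k ∈ Bcol q, d q.1 k) *
          Real.log (((∑ p ∈ IncR, ∑ i ∈ Brow p, d i p.1) + ∑ q ∈ IncC, ∑ k ∈ Bcol q, d q.1 k) / ε) +
        2 := by
  -- fold the masses `σ p`, `τ q` and the widths `x p`, `y q` of the two families
  obtain ⟨σ, hσ⟩ : ∃ σ : Fin n × Fin m → ℝ, ∀ p, σ p = ∑ i ∈ Brow p, d i p.1 := ⟨_, fun _ => rfl⟩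
  obtain ⟨τ, hτ⟩ : ∃ τ : Fin n × Fin m → ℝ, ∀ q, τ q = ∑ k ∈ Bcol q, d q.1 k := ⟨_, fun _ => rfl⟩
  obtain ⟨x, hx⟩ : ∃ x : Fin n × Fin m → ℝ, ∀ p, x p = max ((Brow p).card : ℝ) 1 :=
    ⟨_, fun _ => rfl⟩
  obtain ⟨y, hy⟩ : ∃ y : Fin n × Fin m → ℝ, ∀ q, y q = max ((Bcol q).card : ℝ) 1 :=
    ⟨_, fun _ => rfl⟩
  simp only [← hσ, ← hτ, ← hx, ← hy]
  set P : Finset (Fin n) := IncR.image Prod.fst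
  set V : Finset (Fin n) := IncC.image Prod.fst
  set S : ℝ := (∑ p ∈ IncR, σ p) + ∑ q ∈ IncC, τ q with hS_def
  /- (0) positivity bookkeeping -/
  have hAc : (0 : ℝ) < A.card := Nat.cast_pos.2 hA.card_pos
  have hnR : (2 : ℝ) ≤ n := by exact_mod_cast hn
  have hn0 : (0 : ℝ) < n := by linarith
  have hd0 : ∀ i j, 0 ≤ d i j := fun i j => by
    rw [hd]
    exact div_nonneg (Nat.cast_nonneg _) hAc.le
  have hσ0 : ∀ p, 0 ≤ σ p := fun p => by
    rw [hσ]
    exact Finset.sum_nonneg fun i _ => hd0 i p.1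
  have hτ0 : ∀ q, 0 ≤ τ q := fun q => by
    rw [hτ]
    exact Finset.sum_nonneg fun k _ => hd0 q.1 k
  have hσε : ∀ p ∈ IncR, ε ≤ σ p := fun p hp => by
    rw [hσ]
    exact hεR p hp
  have hτε : ∀ q ∈ IncC, ε ≤ τ q := fun q hq => by
    rw [hτ]
    exact hεC q hq
  have hσpos : ∀ p ∈ IncR, 0 < σ p := fun p hp => hε.trans_le (hσε p hp)
  have hτpos : ∀ q ∈ IncC, 0 < τ q := fun q hq => hε.trans_le (hτε q hq)
  have hsumσ : 0 ≤ ∑ p ∈ IncR, σ p := Finset.sum_nonneg fun p _ => hσ0 p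
  have hsumτ : 0 ≤ ∑ q ∈ IncC, τ q := Finset.sum_nonneg fun q _ => hτ0 q
  have hσS : ∀ p ∈ IncR, σ p ≤ S := fun p hp =>
    (Finset.single_le_sum (fun q _ => hσ0 q) hp).trans (le_add_of_nonneg_right hsumτ)
  have hτS : ∀ q ∈ IncC, τ q ≤ S := fun q hq =>
    (Finset.single_le_sum (fun q _ => hτ0 q) hq).trans (le_add_of_nonneg_left hsumσ)
  have hSR : ∀ p ∈ IncR, 0 < S := fun p hp => (hσpos p hp).trans_le (hσS p hp)
  have hSC : ∀ q ∈ IncC, 0 < S := fun q hq => (hτpos q hq).trans_le (hτS q hq)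
  have hx1 : ∀ p, 1 ≤ x p := fun p => by
    rw [hx]
    exact le_max_right _ _
  have hy1 : ∀ q, 1 ≤ y q := fun q => by
    rw [hy]
    exact le_max_right _ _
  have hBx : ∀ p, ((Brow p).card : ℝ) ≤ x p := fun p => by
    rw [hx]
    exact le_max_left _ _
  have hBy : ∀ q, ((Bcol q).card : ℝ) ≤ y q := fun q => by
    rw [hy]
    exact le_max_left _ _
  /- (1) the weights `λ p = max 1 (n σ p/(x p S))` (rows), `μ q = max 1 (n τ q/(y q S))` (columns),
  `φ k v = 1 + ∑_{p ∈ IncR at position k} [v ∈ Brow p] (λ p - 1)` and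
  `ψ i w = 1 + ∑_{q ∈ IncC at value i} [w ∈ Bcol q] (μ q - 1)` -/
  set lam : Fin n × Fin m → ℝ := fun p => max 1 (n * σ p / (x p * S))
  set mu : Fin n × Fin m → ℝ := fun q => max 1 (n * τ q / (y q * S))
  have hlam1 : ∀ p, 1 ≤ lam p := fun p => le_max_left _ _
  have hmu1 : ∀ q, 1 ≤ mu q := fun q => le_max_left _ _
  set φ : Fin n → Fin n → ℝ := fun k v =>
    1 + ∑ p ∈ IncR.filter (fun p => p.1 = k), if v ∈ Brow p then lam p - 1 else 0 with hφ_def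
  set ψ : Fin n → Fin n → ℝ := fun i w =>
    1 + ∑ q ∈ IncC.filter (fun q => q.1 = i), if w ∈ Bcol q then mu q - 1 else 0 with hψ_def
  have hφ1 : ∀ k v, 1 ≤ φ k v := fun k v => by
    simp only [hφ_def]
    exact one_le_blockWeight Brow IncR lam hlam1 k v
  have hψ1 : ∀ i w, 1 ≤ ψ i w := fun i w => by
    simp only [hψ_def]
    exact one_le_blockWeight Bcol IncC mu hmu1 i w
  -- disjointness: at a value of `IncC` every row weight is `1`
  have hφV : ∀ k ∈ P, ∀ v ∈ V, φ k v ≤ 1 := by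
    intro k _ v hv
    obtain ⟨q, hq, rfl⟩ := Finset.mem_image.1 hv
    simp only [hφ_def]
    refine le_of_eq ?_
    rw [Finset.sum_eq_zero fun p hp => if_neg (hdisj p (Finset.mem_filter.1 hp).1 q hq), add_zero]
  /- (2) the mixed certificate -/
  obtain ⟨hPVn, hB2⟩ := mixed_few (r := P.card + V.card) hn (by push_cast; exact hPV)
  have hcert := log_density_ge_certificate_mixed A hA P V hPVn φ ψ hφ1 hψ1 hφV
  /- (3) its left-hand side is `∑_{p ∈ IncR} σ p log λ p + ∑_{q ∈ IncC} τ q log μ q` -/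
  have hcnt : ∀ i j, ((A.filter fun a => a j = i).card : ℝ) = A.card * d i j := fun i j => by
    rw [hd]
    exact (mul_div_cancel₀ _ hAc.ne').symm
  have hcnt' : ∀ i k, ((A.filter fun a => a⁻¹ i = k).card : ℝ) = A.card * d i k := fun i k => by
    have hfilt : (A.filter fun a => a⁻¹ i = k) = A.filter fun a => a k = i :=
      Finset.filter_congr fun a _ => Equiv.Perm.inv_eq_iff_eq.trans eq_comm
    rw [hfilt, hcnt]
  have hptR : ∀ a : Equiv.Perm (Fin n), ∑ k ∈ P, Real.log (φ k (a k)) =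
      ∑ p ∈ IncR, if a p.1 ∈ Brow p then Real.log (lam p) else 0 := fun a => by
    simp only [hφ_def]
    exact sum_log_blockWeight Brow hBrow IncR lam a
  have hptC : ∀ a : Equiv.Perm (Fin n), ∑ v ∈ V, Real.log (ψ v (a⁻¹ v)) =
      ∑ q ∈ IncC, if a⁻¹ q.1 ∈ Bcol q then Real.log (mu q) else 0 := fun a => by
    simp only [hψ_def]
    exact sum_log_blockWeight Bcol hBcol IncC mu (⇑a⁻¹)
  have hblockR : ∀ p, ∑ a ∈ A, (if a p.1 ∈ Brow p then Real.log (lam p) else 0) =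
      A.card * (σ p * Real.log (lam p)) := fun p => by
    rw [sum_ite_mem_eq A (fun a => a p.1) (Brow p) (Real.log (lam p)), hσ, Finset.sum_mul,
      Finset.sum_mul, Finset.mul_sum]
    refine Finset.sum_congr rfl fun i _ => ?_
    rw [hcnt]
    ring
  have hblockC : ∀ q, ∑ a ∈ A, (if a⁻¹ q.1 ∈ Bcol q then Real.log (mu q) else 0) =
      A.card * (τ q * Real.log (mu q)) := fun q => by
    rw [sum_ite_mem_eq A (fun a => a⁻¹ q.1) (Bcol q) (Real.log (mu q)), hτ, Finset.sum_mul,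
      Finset.sum_mul, Finset.mul_sum]
    refine Finset.sum_congr rfl fun k _ => ?_
    rw [hcnt']
    ring
  have hLR : ∑ a ∈ A, ∑ k ∈ P, Real.log (φ k (a k)) =
      A.card * ∑ p ∈ IncR, σ p * Real.log (lam p) := by
    rw [Finset.sum_congr rfl fun a _ => hptR a, Finset.sum_comm,
      Finset.sum_congr rfl fun p _ => hblockR p, ← Finset.mul_sum]
  have hLC : ∑ a ∈ A, ∑ v ∈ V, Real.log (ψ v (a⁻¹ v)) =
      A.card * ∑ q ∈ IncC, τ q * Real.log (mu q) := by
    rw [Finset.sum_congr rfl fun a _ => hptC a, Finset.sum_comm,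
      Finset.sum_congr rfl fun q _ => hblockC q, ← Finset.mul_sum]
  have hL : (∑ a ∈ A, ((∑ k ∈ P, Real.log (φ k (a k))) + ∑ v ∈ V, Real.log (ψ v (a⁻¹ v)))) /
      A.card = (∑ p ∈ IncR, σ p * Real.log (lam p)) + ∑ q ∈ IncC, τ q * Real.log (mu q) := by
    rw [Finset.sum_add_distrib, hLR, hLC, ← mul_add, mul_div_cancel_left₀ _ hAc.ne']
  -- ... which dominates the claimed left side minus `S log (S/ε)`
  have hlowR : ∀ p ∈ IncR, σ p * (Real.log n - Real.log (x p)) - σ p * Real.log (S / ε) ≤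
      σ p * Real.log (lam p) := fun p hp =>
    mixed_atom_low hn0 hε (hσε p hp) (hσS p hp) (hx1 p)
  have hlowC : ∀ q ∈ IncC, τ q * (Real.log n - Real.log (y q)) - τ q * Real.log (S / ε) ≤
      τ q * Real.log (mu q) := fun q hq =>
    mixed_atom_low hn0 hε (hτε q hq) (hτS q hq) (hy1 q)
  have hsum_low : (∑ p ∈ IncR, σ p * (Real.log n - Real.log (x p))) +
      (∑ q ∈ IncC, τ q * (Real.log n - Real.log (y q))) - S * Real.log (S / ε) ≤
      (∑ p ∈ IncR, σ p * Real.log (lam p)) + ∑ q ∈ IncC, τ q * Real.log (mu q) := by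
    have hSmul : S * Real.log (S / ε) = (∑ p ∈ IncR, σ p * Real.log (S / ε)) +
        ∑ q ∈ IncC, τ q * Real.log (S / ε) := by
      rw [hS_def, add_mul, Finset.sum_mul, Finset.sum_mul]
    have h1 := Finset.sum_le_sum hlowR
    have h2 := Finset.sum_le_sum hlowC
    rw [Finset.sum_sub_distrib] at h1 h2
    linarith
  /- (4) the right-hand side: the column sums of `φ` and of `ψ` ... -/
  have hcolR : ∀ k ∈ P, Real.log ((∑ w, φ k w) / n) ≤
      ∑ p ∈ IncR.filter (fun p => p.1 = k), σ p / S := fun k _ => by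
    simp only [hφ_def]
    exact log_colsum_blockWeight_le hn0 Brow IncR lam (fun p => σ p / S) hlam1 k fun p hp =>
      mixed_atom_col hn0 (hσpos p (Finset.mem_filter.1 hp).1) (hSR p (Finset.mem_filter.1 hp).1)
        (hx1 p) (hBx p)
  have hcolC : ∀ i ∈ V, Real.log ((∑ w, ψ i w) / n) ≤
      ∑ q ∈ IncC.filter (fun q => q.1 = i), τ q / S := fun i _ => by
    simp only [hψ_def]
    exact log_colsum_blockWeight_le hn0 Bcol IncC mu (fun q => τ q / S) hmu1 i fun q hq =>
      mixed_atom_col hn0 (hτpos q (Finset.mem_filter.1 hq).1) (hSC q (Finset.mem_filter.1 hq).1)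
        (hy1 q) (hBy q)
  -- ... sum to at most `S/S ≤ 1` over the positions and the values
  have hB1 : (∑ k ∈ P, Real.log ((∑ w, φ k w) / n)) + ∑ v ∈ V, Real.log ((∑ w, ψ v w) / n) ≤
      1 := by
    have hR : ∑ k ∈ P, Real.log ((∑ w, φ k w) / n) ≤ (∑ p ∈ IncR, σ p) / S := by
      refine (Finset.sum_le_sum hcolR).trans (le_of_eq ?_)
      rw [Finset.sum_fiberwise_of_maps_to (t := P) (g := Prod.fst)
        (fun p hp => Finset.mem_image_of_mem Prod.fst hp), Finset.sum_div]
    have hC : ∑ v ∈ V, Real.log ((∑ w, ψ v w) / n) ≤ (∑ q ∈ IncC, τ q) / S := by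
      refine (Finset.sum_le_sum hcolC).trans (le_of_eq ?_)
      rw [Finset.sum_fiberwise_of_maps_to (t := V) (g := Prod.fst)
        (fun q hq => Finset.mem_image_of_mem Prod.fst hq), Finset.sum_div]
    calc (∑ k ∈ P, Real.log ((∑ w, φ k w) / n)) + ∑ v ∈ V, Real.log ((∑ w, ψ v w) / n)
        ≤ (∑ p ∈ IncR, σ p) / S + (∑ q ∈ IncC, τ q) / S := add_le_add hR hC
      _ = S / S := by rw [hS_def, add_div]
      _ ≤ 1 := div_self_le_one S
  /- (5) assemble (`hB2` is the injectivity defect `(|P|+|V|) log (n/(n-|P|-|V|)) ≤ 1`) -/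
  rw [hL] at hcert
  linarith [hsum_low, hB1, hB2, hcert]

end Summit.MatrixMultiplication.MatrixMultiplication.Theorems.PolynomialSlack
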